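import Mathlib.Analysis.SpecialFunctions.ArithmeticGeometricMean
import Mathlib.Analysis.SpecialFunctions.ImproperIntegrals
import Literature.Analysis.SpecialFunctions.ZhouTripleEllipticIntegralProofs
import HarnessLib

/-!
# Gauss's theorem: the complete elliptic integral is `π / (2·AGM)`

For `a, b > 0` let `I(a,b) = ∫₀^∞ dx / √((x² + a²)(x² + b²))` (`gaussAGMIntegral a b`). The tree
already has the two substitution identities for this integral
(`Literature/Analysis/SpecialFunctions/ZhouTripleEllipticIntegralProofs.lean`, there used for
Landen's transformation): `I(a,b) = K(1 − b²/a²)/a`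
(`Literature.Analysis.SpecialFunctions.integral_Ioi_agm_eq_ellipticK`) and Gauss's invariance
`I((a+b)/2, √(ab)) = I(a,b)` (`Literature.Analysis.SpecialFunctions.integral_Ioi_agm_step`,
Newman's substitution `x = (t − ab/t)/2`); and Mathlib has the arithmetic–geometric mean
`NNReal.agm` with the convergence of both AGM sequences
(`Mathlib/Analysis/SpecialFunctions/ArithmeticGeometricMean.lean`). This file supplies the
missing limit step and so the theorem itself:

* `gaussAGMIntegral_eq_pi_div_agm` — **Gauss (1799)**: `I(a,b) = π / (2·M(a,b))`: iterate the
  invariance along `NNReal.agmSequences` (`gaussAGMIntegral_agmSequences`) and squeeze with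
  `π/(2aₙ) ≤ I(aₙ,bₙ) ≤ π/(2bₙ)` (from `I(a,b) = K(1 − b²/a²)/a = K(1 − a²/b²)/b` and
  `K(u) ≤ K(0) = π/2 ≤ K(v)` for `u ≤ 0 ≤ v < 1`, `EllipticKBasic.lean`), `aₙ, bₙ → M(a,b)`;
* `ellipticK_compl_eq_pi_div_agm`, `ellipticK_eq_pi_div_agm`, `completeEllipticK_eq_pi_div_agm` —
  hence `K′(k) = ellipticK (1 − k²) = π/(2·M(1,k))` (`k > 0`) and
  `K(k) = ellipticK (k²) = completeEllipticK k = π/(2·M(1,k′))`, `k′ = √(1−k²)` (`0 ≤ k < 1`):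
  Borwein–Borwein, *Pi and the AGM*, Thm 1.1 — the first theorem of the road by which
  Borwein–Borwein reach the theta parametrisation `K = (π/2)θ₃(q)²` and the singular values
  `K(k_N)` invoked ("[borwein-piagm]", "[bz92]") in
  `Literature.Analysis.FunctionSpaces.BorweinStraubWanZudilin2012_eq_5_3`.

Also recorded: symmetry, `I(c,c) = π/(2c)`, antitonicity of `I` in each argument and the
integrability of the integrand on `ℝ`.

## References

* J. M. Borwein, P. B. Borwein, *Pi and the AGM*, Wiley (1987), §1.1 Thm 1.1 (Gauss).
* C. F. Gauss, *Werke* III, pp. 361–403 (1799; `M(1,√2)·ϖ = π`).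
-/

noncomputable section

open _root_.MeasureTheory _root_.Set _root_.Filter
open scoped _root_.Topology NNReal
open Literature.Probability.RandomPlanarGeometry Literature.Analysis.SpecialFunctions

namespace Literature.Probability.RandomPlanarGeometry

/-! ### Gauss's integral `I(a,b)` -/

/-- **Gauss's integral** `I(a,b) = ∫₀^∞ dx/√((x² + a²)(x² + b²))` (Borwein–Borwein (1.1.1) up to
the normalisation `∫₀^{π/2} dθ/√(a²cos²θ + b²sin²θ) = I(a,b)`, substitution `x = b tan θ`).
[folklore] -/
def gaussAGMIntegral (a b : ℝ) : ℝ :=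
  ∫ x in Ioi (0 : ℝ), 1 / Real.sqrt ((x ^ 2 + a ^ 2) * (x ^ 2 + b ^ 2))

/-- `I(a,b) = K(1 − b²/a²)/a` (`a, b > 0`; the tree's `integral_Ioi_agm_eq_ellipticK`). [folklore] -/
theorem gaussAGMIntegral_eq_ellipticK {a b : ℝ} (ha : 0 < a) (hb : 0 < b) :
    gaussAGMIntegral a b = 1 / a * ellipticK (1 - b ^ 2 / a ^ 2) :=
  integral_Ioi_agm_eq_ellipticK ha hb

/-- `I(a,b) = I(b,a)`. [folklore] -/
theorem gaussAGMIntegral_comm (a b : ℝ) : gaussAGMIntegral a b = gaussAGMIntegral b a := by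
  unfold gaussAGMIntegral
  congr 1
  funext x
  rw [mul_comm]

/-- **`I(c,c) = π/(2c)`** (`= K(0)/c`). [folklore] -/
theorem gaussAGMIntegral_self {c : ℝ} (hc : 0 < c) : gaussAGMIntegral c c = Real.pi / (2 * c) := by
  rw [gaussAGMIntegral_eq_ellipticK hc hc, div_self (pow_pos hc 2).ne', sub_self, ellipticK_zero]
  field_simp

/-- **Gauss–Landen invariance** `I((a+b)/2, √(ab)) = I(a,b)` for `a, b > 0` (the tree's
`integral_Ioi_agm_step`, Newman's substitution). [folklore] -/
theorem gaussAGMIntegral_agm_step {a b : ℝ} (ha : 0 < a) (hb : 0 < b) :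
    gaussAGMIntegral ((a + b) / 2) (Real.sqrt (a * b)) = gaussAGMIntegral a b := by
  unfold gaussAGMIntegral
  rw [← integral_Ioi_agm_step ha hb, Real.sq_sqrt (mul_pos ha hb).le]

/-- Lower squeeze bound: `π/(2a) ≤ I(a,b)` for `0 < b ≤ a` (`I = K(1 − b²/a²)/a`, `K ≥ K(0) = π/2`
on `[0,1)`). [folklore] -/
theorem pi_div_le_gaussAGMIntegral {a b : ℝ} (hb : 0 < b) (hba : b ≤ a) :
    Real.pi / (2 * a) ≤ gaussAGMIntegral a b := by
  have ha : 0 < a := hb.trans_le hba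
  rw [gaussAGMIntegral_eq_ellipticK ha hb]
  have h0 : 0 ≤ 1 - b ^ 2 / a ^ 2 := by
    rw [sub_nonneg, div_le_one (pow_pos ha 2)]
    exact pow_le_pow_left₀ hb.le hba 2
  have h1 : 1 - b ^ 2 / a ^ 2 < 1 := by
    have : 0 < b ^ 2 / a ^ 2 := by positivity
    linarith
  have hK := pi_div_two_le_ellipticK h0 h1
  calc Real.pi / (2 * a) = 1 / a * (Real.pi / 2) := by field_simp
    _ ≤ 1 / a * ellipticK (1 - b ^ 2 / a ^ 2) :=
        mul_le_mul_of_nonneg_left hK (by positivity)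

/-- Upper squeeze bound: `I(a,b) ≤ π/(2b)` for `0 < b ≤ a` (`I = K(1 − a²/b²)/b` by symmetry,
`K(u) ≤ K(0) = π/2` for `u ≤ 0`). [folklore] -/
theorem gaussAGMIntegral_le_pi_div {a b : ℝ} (hb : 0 < b) (hba : b ≤ a) :
    gaussAGMIntegral a b ≤ Real.pi / (2 * b) := by
  have ha : 0 < a := hb.trans_le hba
  rw [gaussAGMIntegral_comm, gaussAGMIntegral_eq_ellipticK hb ha]
  have h0 : 1 - a ^ 2 / b ^ 2 ≤ 0 := by
    rw [sub_nonpos, one_le_div (pow_pos hb 2)]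
    exact pow_le_pow_left₀ hb.le hba 2
  have hK : ellipticK (1 - a ^ 2 / b ^ 2) ≤ Real.pi / 2 := by
    rw [← ellipticK_zero]
    exact ellipticK_mono h0 one_pos
  calc 1 / b * ellipticK (1 - a ^ 2 / b ^ 2) ≤ 1 / b * (Real.pi / 2) :=
        mul_le_mul_of_nonneg_left hK (by positivity)
    _ = Real.pi / (2 * b) := by field_simp

/-! ### Gauss's theorem `I(a,b) = π/(2 M(a,b))` -/

/-- Along Mathlib's AGM iteration the integral is constant:
`I(aₙ, bₙ) = I(x, y)` with `(bₙ, aₙ) = NNReal.agmSequences x y n`. [folklore] -/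
theorem gaussAGMIntegral_agmSequences {x y : ℝ≥0} (hx : 0 < x) (hy : 0 < y) (n : ℕ) :
    gaussAGMIntegral ((NNReal.agmSequences x y n).2 : ℝ) ((NNReal.agmSequences x y n).1 : ℝ)
      = gaussAGMIntegral x y := by
  induction n generalizing x y with
  | zero =>
    have hx' : (0:ℝ) < x := NNReal.coe_pos.2 hx
    have hy' : (0:ℝ) < y := NNReal.coe_pos.2 hy
    simp only [NNReal.agmSequences_zero, NNReal.coe_div, NNReal.coe_add, Real.coe_sqrt,
      NNReal.coe_mul, NNReal.coe_ofNat]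
    exact gaussAGMIntegral_agm_step hx' hy'
  | succ n ih =>
    have hx' : (0:ℝ) < x := NNReal.coe_pos.2 hx
    have hy' : (0:ℝ) < y := NNReal.coe_pos.2 hy
    have h1 : 0 < NNReal.sqrt (x * y) := NNReal.sqrt_pos.2 (mul_pos hx hy)
    have h2 : 0 < (x + y) / 2 := by positivity
    rw [NNReal.agmSequences_succ, ih h1 h2, gaussAGMIntegral_comm]
    push_cast
    exact gaussAGMIntegral_agm_step hx' hy'

/-- **Gauss's theorem** (1799; Borwein–Borwein, *Pi and the AGM*, Thm 1.1):
`∫₀^∞ dx/√((x²+a²)(x²+b²)) = π / (2·M(a,b))` for `a, b > 0`, `M` the arithmetic–geometric mean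
(`NNReal.agm`). Proof: invariance along the AGM iteration and the squeeze
`π/(2aₙ) ≤ I(aₙ,bₙ) ≤ π/(2bₙ)`, `aₙ, bₙ → M(a,b)`. [folklore] -/
theorem gaussAGMIntegral_eq_pi_div_agm {x y : ℝ≥0} (hx : 0 < x) (hy : 0 < y) :
    gaussAGMIntegral x y = Real.pi / (2 * NNReal.agm x y) := by
  have hM : 0 < NNReal.agm x y := NNReal.agm_pos hx hy
  have hb0 : ∀ n, 0 < (NNReal.agmSequences x y n).1 := fun n =>
    lt_of_lt_of_le (NNReal.sqrt_pos.2 (mul_pos hx hy))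
      (by simpa using NNReal.agmSequences_fst_monotone (x := x) (y := y) (Nat.zero_le n))
  have hba : ∀ n, ((NNReal.agmSequences x y n).1 : ℝ) ≤ (NNReal.agmSequences x y n).2 := fun n =>
    NNReal.coe_le_coe.2 (NNReal.agmSequences_fst_le_snd n n)
  have hlow : ∀ n, Real.pi / (2 * ((NNReal.agmSequences x y n).2 : ℝ)) ≤ gaussAGMIntegral x y :=
    fun n => by
      rw [← gaussAGMIntegral_agmSequences hx hy n]
      exact pi_div_le_gaussAGMIntegral (NNReal.coe_pos.2 (hb0 n)) (hba n)
  have hup : ∀ n, gaussAGMIntegral x y ≤ Real.pi / (2 * ((NNReal.agmSequences x y n).1 : ℝ)) :=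
    fun n => by
      rw [← gaussAGMIntegral_agmSequences hx hy n]
      exact gaussAGMIntegral_le_pi_div (NNReal.coe_pos.2 (hb0 n)) (hba n)
  have hA : Tendsto (fun n => Real.pi / (2 * ((NNReal.agmSequences x y n).2 : ℝ))) atTop
      (𝓝 (Real.pi / (2 * NNReal.agm x y))) :=
    tendsto_const_nhds.div (tendsto_const_nhds.mul
      (NNReal.tendsto_coe.2 NNReal.tendsto_agmSequences_snd_agm)) (by positivity)
  have hB : Tendsto (fun n => Real.pi / (2 * ((NNReal.agmSequences x y n).1 : ℝ))) atTop
      (𝓝 (Real.pi / (2 * NNReal.agm x y))) :=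
    tendsto_const_nhds.div (tendsto_const_nhds.mul
      (NNReal.tendsto_coe.2 NNReal.tendsto_agmSequences_fst_agm)) (by positivity)
  exact le_antisymm (ge_of_tendsto' hB hup) (le_of_tendsto' hA hlow)

/-! ### The complete elliptic integral through the AGM -/

/-- **`K′(k) = π / (2·M(1,k))`** (`k > 0`): the complementary complete elliptic integral through
the arithmetic–geometric mean (Borwein–Borwein Thm 1.1 (b); `K′(k) = ellipticK (1 − k²) = I(1,k)`).
[folklore] -/
theorem ellipticK_compl_eq_pi_div_agm {k : ℝ≥0} (hk : 0 < k) :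
    ellipticK (1 - (k:ℝ) ^ 2) = Real.pi / (2 * NNReal.agm 1 k) := by
  have h := gaussAGMIntegral_eq_pi_div_agm one_pos hk
  rw [NNReal.coe_one, gaussAGMIntegral_eq_ellipticK one_pos (NNReal.coe_pos.2 hk)] at h
  simpa using h

/-- **Gauss's AGM formula for `K`** (parameter convention): for `0 ≤ k < 1`, with `k′ = √(1 − k²)`,
`K(k) = ellipticK (k²) = π / (2·M(1, k′))` (Borwein–Borwein, *Pi and the AGM*, Thm 1.1;
e.g. `K(1/√2) = π/(2 M(1, 1/√2))`, Gauss 1799). [folklore] -/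
theorem ellipticK_eq_pi_div_agm {k : ℝ} (hk0 : 0 ≤ k) (hk1 : k < 1) :
    ellipticK (k ^ 2) =
      Real.pi / (2 * NNReal.agm 1 ⟨Real.sqrt (1 - k ^ 2), Real.sqrt_nonneg _⟩) := by
  have hk' : 0 < Real.sqrt (1 - k ^ 2) := Real.sqrt_pos.2 (by nlinarith)
  have h := ellipticK_compl_eq_pi_div_agm (k := ⟨Real.sqrt (1 - k ^ 2), Real.sqrt_nonneg _⟩) hk'
  have e : 1 - (Real.sqrt (1 - k ^ 2)) ^ 2 = k ^ 2 := by
    rw [Real.sq_sqrt (by nlinarith)]; ring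
  have h' : ellipticK (1 - Real.sqrt (1 - k ^ 2) ^ 2) =
      Real.pi / (2 * NNReal.agm 1 ⟨Real.sqrt (1 - k ^ 2), Real.sqrt_nonneg _⟩) := h
  rw [e] at h'
  exact h'

/-- The same in the modulus convention of `Literature.Analysis.SpecialFunctions.completeEllipticK`:
`completeEllipticK k = π / (2·M(1, √(1−k²)))` for `0 ≤ k < 1`. [folklore] -/
theorem completeEllipticK_eq_pi_div_agm {k : ℝ} (hk0 : 0 ≤ k) (hk1 : k < 1) :
    completeEllipticK k =
      Real.pi / (2 * NNReal.agm 1 ⟨Real.sqrt (1 - k ^ 2), Real.sqrt_nonneg _⟩) := by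
  rw [completeEllipticK_eq_ellipticK]
  exact ellipticK_eq_pi_div_agm hk0 hk1

/-! ### Supplements: integrability and monotonicity of `I` -/

/-- The integrand of `I(a,b)` is integrable on `ℝ` for `a, b > 0` (it is `O(x⁻²)`; compare
`1/√((x²+a²)(x²+b²)) ≤ 1/(x²+m²)`, `m = min a b`). [folklore] -/
theorem integrable_gaussAGMIntegrand {a b : ℝ} (ha : 0 < a) (hb : 0 < b) :
    Integrable (fun x : ℝ => 1 / Real.sqrt ((x ^ 2 + a ^ 2) * (x ^ 2 + b ^ 2))) := by
  set m := min a b with hm_def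
  have hm : 0 < m := lt_min ha hb
  have hint : Integrable (fun x : ℝ => m⁻¹ ^ 2 * (1 + (m⁻¹ * x) ^ 2)⁻¹) :=
    (integrable_inv_one_add_sq.comp_mul_left' (inv_ne_zero hm.ne')).const_mul _
  have hcont : Continuous fun x : ℝ => 1 / Real.sqrt ((x ^ 2 + a ^ 2) * (x ^ 2 + b ^ 2)) := by
    refine continuous_const.div (by fun_prop) fun x => ?_
    exact (Real.sqrt_pos.2 (by positivity)).ne'
  refine hint.mono' hcont.aestronglyMeasurable (Eventually.of_forall fun x => ?_)
  have hxa : x ^ 2 + m ^ 2 ≤ x ^ 2 + a ^ 2 := by nlinarith [min_le_left a b]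
  have hxb : x ^ 2 + m ^ 2 ≤ x ^ 2 + b ^ 2 := by nlinarith [min_le_right a b]
  have h1 : (x ^ 2 + m ^ 2) ^ 2 ≤ (x ^ 2 + a ^ 2) * (x ^ 2 + b ^ 2) := by
    rw [sq]; exact mul_le_mul hxa hxb (by positivity) (by positivity)
  have hpos : 0 < x ^ 2 + m ^ 2 := by positivity
  rw [Real.norm_of_nonneg (by positivity)]
  calc 1 / Real.sqrt ((x ^ 2 + a ^ 2) * (x ^ 2 + b ^ 2)) ≤ 1 / Real.sqrt ((x ^ 2 + m ^ 2) ^ 2) :=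
        one_div_le_one_div_of_le (Real.sqrt_pos.2 (by positivity)) (Real.sqrt_le_sqrt h1)
    _ = 1 / (x ^ 2 + m ^ 2) := by rw [Real.sqrt_sq hpos.le]
    _ = m⁻¹ ^ 2 * (1 + (m⁻¹ * x) ^ 2)⁻¹ := by
        field_simp
        ring

/-- `I(a,b)` is antitone in `a`: `0 < a ≤ a'` gives `I(a',b) ≤ I(a,b)` (and likewise in `b`, by
`gaussAGMIntegral_comm`). [folklore] -/
theorem gaussAGMIntegral_anti_left {a a' b : ℝ} (ha : 0 < a) (haa' : a ≤ a') (hb : 0 < b) :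
    gaussAGMIntegral a' b ≤ gaussAGMIntegral a b := by
  unfold gaussAGMIntegral
  refine setIntegral_mono_on (integrable_gaussAGMIntegrand (ha.trans_le haa') hb).integrableOn
    (integrable_gaussAGMIntegrand ha hb).integrableOn measurableSet_Ioi fun x _ => ?_
  apply one_div_le_one_div_of_le (Real.sqrt_pos.2 (by positivity))
  apply Real.sqrt_le_sqrt
  apply mul_le_mul_of_nonneg_right _ (by positivity)
  nlinarith

end Literature.Probability.RandomPlanarGeometry

end
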